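import Summits.BirchSwinnertonDyer.BirchSwinnertonDyer.Theses.PrintX9
import Literature.NumberTheory.EllipticCurves.NeronIsogenyScalingHoldsProofs
import HarnessLib

/-!
# Route `PrintX9`, aside 20536 (`NeronScalingIntegralOfMinimal`): DISCHARGED by the tree's theorem
# `integral_neronScaling_of_isGloballyMinimal_holds` (cell `bsd-print-x9`, unit `bsd-print-x9-p4`)

HONEST FRAMING (cell `bsd-print-x9`, HOME `run/shared/lean/pub/bsd-print-x9/`): the route's cite-only
aside `NeronScalingIntegralOfMinimal` is the named fact
`Literature.NumberTheory.EllipticCurves.integral_neronScaling_of_isGloballyMinimal` (integrality of the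
Néron-differential scaling of a period-lattice comparison from a globally minimal model; conjunct 12 of
`HeegnerPrintFactsX9`), which the tree PROVES (`NeronIsogenyScalingHoldsProofs.lean`). This file records
the discharge so the item closes by name; no mathematics of its own. [cite: SilvermanAEC2009, VII §1 and VIII §8]
-/

set_option autoImplicit false
set_option linter.dupNamespace false

namespace Summit.BirchSwinnertonDyer.BirchSwinnertonDyer.Rank1Residual

/-- **Aside 20536 discharged**: `Theses.PrintX9.NeronScalingIntegralOfMinimal` IS the proved tree theorem
`integral_neronScaling_of_isGloballyMinimal_holds`. [cite: SilvermanAEC2009, VII Prop. 1.3 (b) and VIII §8] -/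
theorem neronScalingIntegralOfMinimal_proof :
    Summit.BirchSwinnertonDyer.BirchSwinnertonDyer.Theses.PrintX9.NeronScalingIntegralOfMinimal := by
  unfold Summit.BirchSwinnertonDyer.BirchSwinnertonDyer.Theses.PrintX9.NeronScalingIntegralOfMinimal
  exact Literature.NumberTheory.EllipticCurves.integral_neronScaling_of_isGloballyMinimal_holds

end Summit.BirchSwinnertonDyer.BirchSwinnertonDyer.Rank1Residual
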